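import Mathlib
import Literature.MathematicalPhysics.QuantumLattice.Imbrie2016.UmbilicPlanes

/-!
# The `B_F(1)` chart of the three-spin block: cluster frame and the compression table

Finite algebraic facts (hypotheses (H1), (H2)-cleanliness of the 'free qubit ⊗ pair' template) at
the umbilic stratum `B_F(1)` of the three-spin block,
[cite: ImbrieJSP2016, eq. (1.1), assumption LLA(ν, C)]  Repair cell b2b-imbrie, LLA.md block
Q8(c),(d) (template theorem and the local law at `B_F(1) ∪ B_F(1)′`), refereed in REFEREE.md G277,
G278.  J. Z. Imbrie, *On many-body localization for quantum spin chains*,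
J. Stat. Phys. 163 (2016) 998–1048, arXiv:1403.7837 (Theorem 1.1, Assumption LLA).

At `b(θ) ∈ B_F(1)` the block Hamiltonian is `H(b) = s·(X₂ + cos θ Z₃ + sin θ X₃)` (site 1 carries
no field: the FREE QUBIT).  With `p = cos(θ/2)`, `q = sin(θ/2)` (`p² + q² = 1`, so `cos θ = p² − q²`,
`sin θ = 2pq`) the `±1` eigenvectors of `cos θ Z + sin θ X` are `u⁺ = (p, q)`, `u⁻ = (−q, p)`, those
of `X` are `(1, ±1)` (unnormalised), and the zero-energy CLUSTER SPACE is
`T = ℂ²₁ ⊗ span{χ₊, χ₋}`, `χ₊ = (1,1) ⊗ u⁻`, `χ₋ = (1,−1) ⊗ u⁺`.  The frame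
`f i α = e_i ⊗ χ_α` (`i` = free-qubit index, `α = 0 ↦ χ₊`, `α = 1 ↦ χ₋`) is orthogonal with
squared norms `2` (`frame_gram`), lies in `ker H(b)` (`cluster_kernel`), and the eight generators
`Z₁, Z₂, Z₃, X₁, X₂, X₃, Z₁Z₂, Z₂Z₃` compress to `T` as (Gram matrices, factor 2 = squared norm):
`Z₁ ↦ Z⊗1`, `X₁ ↦ X⊗1`, `X₂ ↦ 1⊗τ_z`, `Z₂ ↦ 0`, `Z₃ ↦ −cos θ·1⊗τ_z`, `X₃ ↦ −sin θ·1⊗τ_z`,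
`Z₁Z₂ ↦ 0`, `Z₂Z₃ ↦ −sin θ·1⊗τ_x` — every compression is 'one-body ⊗ 1' or '1 ⊗ one-body'
(CLEANLINESS: no `Z⊗τ` part in any of the eight directions), the swept directions `h₁, t₁, t₂`
give `Z⊗1, X⊗1, 1⊗τ_z` ((H1)), and the only `τ_x`-feed is `Z₂Z₃`, i.e. the FROZEN direction `J₂`
(the coefficient `d_x = −J₂ sin θ` of LLA.md Q8(d)).  Kets are real functions of the three basis
indices as in `UmbilicPlanes`; everything is polynomial algebra in `p, q`.
-/

namespace Literature.MathematicalPhysics.QuantumLattice.Imbrie2016.ChartBF1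

open UmbilicPlanes (Ket sgn transverse diag)

/-- [cite: ImbrieJSP2016, eq. (1.1)] `u⁺ = (p, q)`: the `+1` eigenvector of `cos θ Z + sin θ X`,
`p = cos(θ/2)`, `q = sin(θ/2)`. -/
def uP (p q : ℝ) (c : Fin 2) : ℝ := if c = 0 then p else q

/-- [cite: ImbrieJSP2016, eq. (1.1)] `u⁻ = (−q, p)`: the `−1` eigenvector of `cos θ Z + sin θ X`. -/
def uM (p q : ℝ) (c : Fin 2) : ℝ := if c = 0 then -q else p

/-- [cite: ImbrieJSP2016, eq. (1.1)] The pair states: `χ 0 = (1,1) ⊗ u⁻` (`X₂ = +1`, third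
factor `−1`), `χ 1 = (1,−1) ⊗ u⁺` (`X₂ = −1`, third factor `+1`); both of energy `0`. -/
def chi (p q : ℝ) (α : Fin 2) (b c : Fin 2) : ℝ :=
  if α = 0 then uM p q c else sgn b * uP p q c

/-- [cite: ImbrieJSP2016, eq. (1.1)] The cluster frame `f i α = e_i ⊗ χ_α` of
`T = ℂ²₁ ⊗ span{χ₊, χ₋}` (free qubit = site 1). -/
def frame (p q : ℝ) (i α : Fin 2) : Ket :=
  fun a b c => (if a = i then 1 else 0) * chi p q α b c

/-- [cite: ImbrieJSP2016, eq. (1.1)] The frame is orthogonal with squared norms `2`. -/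
theorem frame_gram (p q : ℝ) (hpq : p ^ 2 + q ^ 2 = 1) (i j α β : Fin 2) :
    UmbilicPlanes.inner (frame p q i α) (frame p q j β) = if i = j ∧ α = β then 2 else 0 := by
  fin_cases i <;> fin_cases j <;> fin_cases α <;> fin_cases β <;>
    norm_num [UmbilicPlanes.inner, frame, chi, uP, uM, sgn, Fin.sum_univ_two] <;> nlinarith [hpq]

/-- [cite: ImbrieJSP2016, eq. (1.1)] `T ⊆ ker H(b)`: `H(b) = s(X₂ + cos θ Z₃ + sin θ X₃)`,
`cos θ = p² − q²`, `sin θ = 2pq`, annihilates every frame vector (any amplitude `s`). -/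
theorem cluster_kernel (p q s : ℝ) (hpq : p ^ 2 + q ^ 2 = 1) (i α : Fin 2) :
    (fun a b c => diag 0 0 0 (s * (p ^ 2 - q ^ 2)) 0 0 (frame p q i α) a b c
      + transverse 0 s (s * (2 * p * q)) (frame p q i α) a b c) = fun _ _ _ => (0 : ℝ) := by
  funext a b c
  fin_cases i <;> fin_cases α <;> fin_cases a <;> fin_cases b <;> fin_cases c <;>
    norm_num [diag, UmbilicPlanes.landscape, transverse, frame, chi, uP, uM, sgn, Fin.rev] <;>
    first
      | linear_combination (s * q) * hpq
      | linear_combination (-(s * q)) * hpq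
      | linear_combination (s * p) * hpq
      | linear_combination (-(s * p)) * hpq

/-- [cite: ImbrieJSP2016, eq. (1.1)] `Z₁ ↦ Z ⊗ 1` on `T` (swept direction `h₁`). -/
theorem compress_Z1 (p q : ℝ) (hpq : p ^ 2 + q ^ 2 = 1) (i j α β : Fin 2) :
    UmbilicPlanes.inner (frame p q i α) (diag 0 1 0 0 0 0 (frame p q j β))
      = if i = j ∧ α = β then 2 * sgn i else 0 := by
  fin_cases i <;> fin_cases j <;> fin_cases α <;> fin_cases β <;>
    norm_num [UmbilicPlanes.inner, diag, UmbilicPlanes.landscape, frame, chi, uP, uM, sgn,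
      Fin.sum_univ_two] <;> nlinarith [hpq]

/-- [cite: ImbrieJSP2016, eq. (1.1)] `X₁ ↦ X ⊗ 1` on `T` (swept direction `t₁`). -/
theorem compress_X1 (p q : ℝ) (hpq : p ^ 2 + q ^ 2 = 1) (i j α β : Fin 2) :
    UmbilicPlanes.inner (frame p q i α) (transverse 1 0 0 (frame p q j β))
      = if i ≠ j ∧ α = β then 2 else 0 := by
  fin_cases i <;> fin_cases j <;> fin_cases α <;> fin_cases β <;>
    norm_num [UmbilicPlanes.inner, transverse, frame, chi, uP, uM, sgn, Fin.sum_univ_two,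
      Fin.rev] <;> nlinarith [hpq]

/-- [cite: ImbrieJSP2016, eq. (1.1)] `X₂ ↦ 1 ⊗ τ_z` on `T` (swept direction `t₂`). -/
theorem compress_X2 (p q : ℝ) (hpq : p ^ 2 + q ^ 2 = 1) (i j α β : Fin 2) :
    UmbilicPlanes.inner (frame p q i α) (transverse 0 1 0 (frame p q j β))
      = if i = j ∧ α = β then 2 * sgn α else 0 := by
  fin_cases i <;> fin_cases j <;> fin_cases α <;> fin_cases β <;>
    norm_num [UmbilicPlanes.inner, transverse, frame, chi, uP, uM, sgn, Fin.sum_univ_two,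
      Fin.rev] <;> nlinarith [hpq]

/-- [cite: ImbrieJSP2016, eq. (1.1)] `Z₂ ↦ 0` on `T`. -/
theorem compress_Z2 (p q : ℝ) (i j α β : Fin 2) :
    UmbilicPlanes.inner (frame p q i α) (diag 0 0 1 0 0 0 (frame p q j β)) = 0 := by
  fin_cases i <;> fin_cases j <;> fin_cases α <;> fin_cases β <;>
    norm_num [UmbilicPlanes.inner, diag, UmbilicPlanes.landscape, frame, chi, uP, uM, sgn,
      Fin.sum_univ_two] <;> ring

/-- [cite: ImbrieJSP2016, eq. (1.1)] `Z₃ ↦ −cos θ · 1 ⊗ τ_z` on `T` (one-body). -/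
theorem compress_Z3 (p q : ℝ) (i j α β : Fin 2) :
    UmbilicPlanes.inner (frame p q i α) (diag 0 0 0 1 0 0 (frame p q j β))
      = if i = j ∧ α = β then -(2 * (p ^ 2 - q ^ 2)) * sgn α else 0 := by
  fin_cases i <;> fin_cases j <;> fin_cases α <;> fin_cases β <;>
    norm_num [UmbilicPlanes.inner, diag, UmbilicPlanes.landscape, frame, chi, uP, uM, sgn,
      Fin.sum_univ_two] <;> ring

/-- [cite: ImbrieJSP2016, eq. (1.1)] `X₃ ↦ −sin θ · 1 ⊗ τ_z` on `T` (one-body). -/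
theorem compress_X3 (p q : ℝ) (i j α β : Fin 2) :
    UmbilicPlanes.inner (frame p q i α) (transverse 0 0 1 (frame p q j β))
      = if i = j ∧ α = β then -(2 * (2 * p * q)) * sgn α else 0 := by
  fin_cases i <;> fin_cases j <;> fin_cases α <;> fin_cases β <;>
    norm_num [UmbilicPlanes.inner, transverse, frame, chi, uP, uM, sgn, Fin.sum_univ_two,
      Fin.rev] <;> ring

/-- [cite: ImbrieJSP2016, eq. (1.1)] `Z₁Z₂ ↦ 0` on `T`. -/
theorem compress_Z1Z2 (p q : ℝ) (i j α β : Fin 2) :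
    UmbilicPlanes.inner (frame p q i α) (diag 0 0 0 0 1 0 (frame p q j β)) = 0 := by
  fin_cases i <;> fin_cases j <;> fin_cases α <;> fin_cases β <;>
    norm_num [UmbilicPlanes.inner, diag, UmbilicPlanes.landscape, frame, chi, uP, uM, sgn,
      Fin.sum_univ_two] <;> ring

/-- [cite: ImbrieJSP2016, eq. (1.1), assumption LLA(ν, C)] `Z₂Z₃ ↦ −sin θ · 1 ⊗ τ_x` on `T`:
the ONLY `τ_x`-feed among the eight generators, along the frozen direction `J₂`
(`d_x = −J₂ sin θ` in LLA.md Q8(d)); in particular no generator has a `Z ⊗ τ` part (cleanliness). -/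
theorem compress_Z2Z3 (p q : ℝ) (i j α β : Fin 2) :
    UmbilicPlanes.inner (frame p q i α) (diag 0 0 0 0 0 1 (frame p q j β))
      = if i = j ∧ α ≠ β then -(2 * (2 * p * q)) else 0 := by
  fin_cases i <;> fin_cases j <;> fin_cases α <;> fin_cases β <;>
    norm_num [UmbilicPlanes.inner, diag, UmbilicPlanes.landscape, frame, chi, uP, uM, sgn,
      Fin.sum_univ_two] <;> ring

end Literature.MathematicalPhysics.QuantumLattice.Imbrie2016.ChartBF1
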